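import Literature.NumberTheory.LFunctions.VinogradovKorobovFarZerosMain
import Literature.NumberTheory.LFunctions.ZetaArgBacklundExplicit
import HarnessLib

/-!
# MTY Lemma 4.6 with an unconditional zero-counting input (the tree's explicit Backlund bound)

Topic `Literature/NumberTheory/LFunctions`, family RH (explicit Vinogradov–Korobov zero-free
regions). Part of the decomposition of MTY's Lemma 4.7
(`Literature.NumberTheory.LFunctions.zero_inequality_mossinghoff_trudgian_yang`). Everything here
is PROVED; no named fact and no definition is introduced.

Mossinghoff–Trudgian–Yang's Lemma 4.6 (the far-zero sum `Σ_{|1+it−ρ| ≥ η} 1/|1+it−ρ|²`) takes its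
`log t`-slope `5.409` and its constant `206.7` from the zero-counting bound (3.8) of
Hasanalizade–Shen–Wong (`|N(T) − M(T)| ≤ 0.1038 log T + 0.2573 log log T + 9.3675`), a named
fact of the tree resting on Platt's database of zeros
(`FarZeros.mty_lemma_4_6_with`, `VinogradovKorobovFarZerosMain.lean`, hypothesis `h38`). The
tree meanwhile PROVES an explicit counting bound outright
(`abs_zetaZeroCount_sub_main_le_explicit`, `ZetaArgBacklundExplicit.lean`:
`|N(T) − M(T)| ≤ 0.3083 log T + 4.128` for `T ≥ 30`). Feeding it through the same partial
summations (Ford's `I₁, I₂, I₃`, the window `|γ − t| < 1`, the annulus integral with MTY Lemma 4.5)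
gives **Lemma 4.6 with the constants `(C₁, C₃) = (9.862, 82.7)` in place of `(5.409, 206.7)`,
unconditionally in the counting input** (`FarZeros.mty_lemma_4_6_explicit`): for `t ≥ 10⁴`,
`0 < η ≤ 1/4`, `A > 1`, `B > 0`, a near-zero bound `N(t,u) ≤ 1.3478u^{3/2}B log t + c₄₅ + …`
(`c₄₅ ≥ 0`; MTY Lemma 4.5 is proved with `c₄₅ = 3.777`, `mty_lemma_4_5`), and every finite set
of strip zeros with `|1+it−ρ| > η`,
`Σ m(ρ)/|1+it−ρ|² ≤ mtyFarZeroBoundGen 9.862 82.7 (c₄₅ − 500/1879) A B t η`.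

Numerics (`L = log t ≥ 9`, `a = 0.3083`, `c = 4.128`, `1/π ≤ 0.31831`, `1/2π ≤ 0.159155`):
window `(80/9)[(0.31831 + 2a)L + 2c + 10⁻⁴] = 8.3104L + 73.388`; `I₁ ≤ (0.15917 + 2a)L + 2c + 0.2140`;
`I₂ ≤ (0.159155 + 2a)L + 2c`; `I₃ ≤ 0.07`; annulus as in `mty_lemma_4_6_with` (`−7.546`); total
slope `9.86184 ≤ 9.862`, constant `82.64 ≤ 82.7`.

* `FarZeros.explicit_bounds` — the two-sided bound unpacked for `u ≥ 30`;
* `FarZeros.count_le_crude_explicit` — `N(u) ≤ u log(u+1) + 10` for all `u ≥ 0`;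
* `FarZeros.window_count_le_explicit` — `N(t+1) − N(t−1) ≤ (1/π)log((t+1)/2π) + q(t+1) + q(t−1)`;
* `FarZeros.mty_lemma_4_6_explicit`.

## References

* M. J. Mossinghoff, T. S. Trudgian, A. Yang, *Explicit zero-free regions for the Riemann
  zeta-function*, Res. Number Theory 10 (2024) (arXiv:2212.06867): Lemma 4.6, (3.8).
  [MossinghoffTrudgianYangRNT2024]
* K. Ford, *Zero-free regions for the Riemann zeta function* (2002) (arXiv:1910.08205): Lemma 4.3
  and its proof (`I₁, I₂, I₃`). [Ford2002Millennium]
-/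

noncomputable section

open Complex Real MeasureTheory Finset Set Filter
open scoped Topology

namespace Literature.NumberTheory.LFunctions

namespace FarZeros

open FordFarZeros (rvmMain)

/-! ## The explicit counting bound as hypotheses for `I₁`, `I₂`, `I₃` and the window -/

/-- The explicit counting bound unpacked: `M(u) − q(u) ≤ N(u) ≤ M(u) + q(u)` for `u ≥ 30`,
`q(u) = 0.3083 log u + 4.128`. [folklore] -/
theorem explicit_bounds {u : ℝ} (hu : 30 ≤ u) :
    rvmMain u - (0.3083 * Real.log u + 4.128) ≤ (zetaZeroCount u : ℝ)
      ∧ (zetaZeroCount u : ℝ) ≤ rvmMain u + (0.3083 * Real.log u + 4.128) := by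
  have h1 := abs_zetaZeroCount_sub_main_le_explicit hu
  rw [abs_le] at h1
  unfold FordFarZeros.rvmMain
  constructor <;> linarith [h1.1, h1.2]

/-- `N(u) ≤ u log(u + 1) + 10` for all `u ≥ 0` (`N(u) ≤ N(30) ≤ 7` below `30`; the explicit bound
and `M(u) ≤ (u/2π) log(u + 1)` above). [folklore] -/
theorem count_le_crude_explicit {u : ℝ} (hu : 0 ≤ u) :
    (zetaZeroCount u : ℝ) ≤ u * Real.log (u + 1) + 10 := by
  have hlog0 : 0 ≤ Real.log (u + 1) := Real.log_nonneg (by linarith)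
  have hul : 0 ≤ u * Real.log (u + 1) := mul_nonneg hu hlog0
  rcases lt_or_ge u 30 with h30 | h30
  · have hN : zetaZeroCount u ≤ 7 := (zetaZeroCount_mono h30.le).trans zetaZeroCount_thirty_le
    have hN' : (zetaZeroCount u : ℝ) ≤ 7 := by exact_mod_cast hN
    linarith
  · have h := (explicit_bounds h30).2
    have hπ := Real.pi_pos
    have hπ3 := Real.pi_gt_three
    have he := Real.exp_one_gt_d9
    have hu0 : 0 < u := by linarith
    have hlog1 : Real.log u ≤ Real.log (u + 1) := Real.log_le_log hu0 (by linarith)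
    have hlog2 : Real.log (u / (2 * π * Real.exp 1)) ≤ Real.log (u + 1) := by
      refine Real.log_le_log (by positivity) ?_
      rw [div_le_iff₀ (by positivity)]
      have h2πe : (16 : ℝ) ≤ 2 * π * Real.exp 1 := by nlinarith [hπ3, he, Real.exp_pos 1]
      have := mul_le_mul_of_nonneg_left h2πe (show (0 : ℝ) ≤ u + 1 by linarith)
      linarith
    have hM : rvmMain u ≤ u / 6 * Real.log (u + 1) := by
      unfold FordFarZeros.rvmMain
      have h1 : u / (2 * π) ≤ u / 6 := div_le_div_of_nonneg_left hu (by norm_num) (by linarith)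
      calc u / (2 * π) * Real.log (u / (2 * π * Real.exp 1)) ≤ u / (2 * π) * Real.log (u + 1) :=
            mul_le_mul_of_nonneg_left hlog2 (by positivity)
        _ ≤ u / 6 * Real.log (u + 1) := mul_le_mul_of_nonneg_right h1 hlog0
    have hlogu : Real.log u ≤ u := (Real.log_le_sub_one_of_pos hu0).trans (by linarith)
    nlinarith [hM, h, hlog1, hlogu, hlog0]

/-- The window count from the explicit bound:
`N(t+1) − N(t−1) ≤ (1/π) log((t+1)/(2π)) + q(t+1) + q(t−1)` for `t ≥ 31` (mean value theorem
for `M`, as in `FordFarZeros.window_count_le`). [folklore] -/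
theorem window_count_le_explicit {t : ℝ} (ht : 31 ≤ t) :
    (zetaZeroCount (t + 1) : ℝ) - zetaZeroCount (t - 1) ≤
      1 / π * Real.log ((t + 1) / (2 * π)) + (0.3083 * Real.log (t + 1) + 4.128)
        + (0.3083 * Real.log (t - 1) + 4.128) := by
  have hπ := Real.pi_pos
  have h1 := (explicit_bounds (show (30 : ℝ) ≤ t + 1 by linarith)).2
  have h2 := (explicit_bounds (show (30 : ℝ) ≤ t - 1 by linarith)).1
  have hMVT : rvmMain (t + 1) - rvmMain (t - 1) ≤ 1 / π * Real.log ((t + 1) / (2 * π)) := by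
    have hcont : ContinuousOn rvmMain (Icc (t - 1) (t + 1)) :=
      FordFarZeros.continuousOn_rvmMain.mono fun u hu ↦ show (0 : ℝ) < u by linarith [hu.1]
    have hdiff : ∀ u ∈ Ioo (t - 1) (t + 1),
        HasDerivAt rvmMain (1 / (2 * π) * Real.log (u / (2 * π))) u :=
      fun u hu ↦ FordFarZeros.hasDerivAt_rvmMain (by linarith [hu.1])
    obtain ⟨ξ, hξ, hξeq⟩ := exists_hasDerivAt_eq_slope rvmMain
      (fun u ↦ 1 / (2 * π) * Real.log (u / (2 * π))) (by linarith) hcont hdiff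
    have hξ0 : 0 < ξ := by linarith [hξ.1]
    have hlog : Real.log (ξ / (2 * π)) ≤ Real.log ((t + 1) / (2 * π)) :=
      Real.log_le_log (by positivity)
        (by rw [div_le_div_iff_of_pos_right (by positivity)]; linarith [hξ.2])
    have e : t + 1 - (t - 1) = 2 := by ring
    rw [e, eq_div_iff (by norm_num)] at hξeq
    have : rvmMain (t + 1) - rvmMain (t - 1) = 2 * (1 / (2 * π) * Real.log (ξ / (2 * π))) := by
      linarith
    rw [this]
    have e2 : 2 * (1 / (2 * π) * Real.log (ξ / (2 * π))) = 1 / π * Real.log (ξ / (2 * π)) := by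
      field_simp
    rw [e2]
    exact mul_le_mul_of_nonneg_left hlog (by positivity)
  linarith

/-! ## Lemma 4.6 with the explicit counting bound -/

set_option maxHeartbeats 1600000 in
/-- **Lemma 4.6 of Mossinghoff–Trudgian–Yang with the tree's explicit zero-counting theorem in
place of (3.8)**: if `N(t,u) ≤ 1.3478 u^{3/2} B log t + c₄₅ + (log A − log u + (2/3) log log t)/1.879`
for `t ≥ 100`, `0 < u ≤ 1/4` (`c₄₅ ≥ 0`), then for `t ≥ 10⁴`, `0 < η ≤ 1/4`, `A > 1`, `B > 0` and
every finite set of strip zeros with `|1 + it − ρ| > η`,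
`Σ m/|1+it−ρ|² ≤ mtyFarZeroBoundGen 9.862 82.7 (c₄₅ − 500/1879) A B t η`, i.e. the bound of
Lemma 4.6 with `(5.409, 206.7)` replaced by `(9.862, 82.7)` — unconditional in the counting input
(`abs_zetaZeroCount_sub_main_le_explicit`, slope `0.3083`, in place of Hasanalizade–Shen–Wong's
`0.1038`). The proof is that of `mty_lemma_4_6_with`, with `q(u) = 0.3083 log u + 4.128` from
`u = 30` on (`sum_upper_ordinates_le_gen`, `FordFarZeros.lower_tail_sum_le`,
`neg_ordinates_sum_le`, `sum_window_part_le`, `annulus_integral_le`).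
[cite: MossinghoffTrudgianYangRNT2024, Lemma 4.6] [cite: Ford2002Millennium, Lemma 4.3] -/
theorem mty_lemma_4_6_explicit
    {A B c45 : ℝ} (hA : 1 < A) (hB : 0 < B) (hc45 : 0 ≤ c45)
    (h45 : ∀ t u : ℝ, 100 ≤ t → 0 < u → u ≤ 1 / 4 →
      fordN t u ≤ 1.3478 * u ^ (3 / 2 : ℝ) * B * Real.log t + c45
        + (Real.log A - Real.log u + 2 / 3 * Real.log (Real.log t)) / 1.879)
    {t η : ℝ} (ht : 10000 ≤ t) (hη : 0 < η) (hη4 : η ≤ 1 / 4) (T : Finset ℂ)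
    (hT : ∀ ρ ∈ T, riemannZeta ρ = 0 ∧ 0 < ρ.re ∧ ρ.re < 1 ∧ η < ‖1 + (t : ℂ) * I - ρ‖) :
    ∑ ρ ∈ T, (riemannZetaZeroOrder ρ : ℝ) / ‖1 + (t : ℂ) * I - ρ‖ ^ 2
      ≤ mtyFarZeroBoundGen 9.862 82.7 (c45 - 500 / 1879) A B t η := by
  classical
  obtain ⟨hL, hLL, hl1, hll1, hl2, hll2, hLt⟩ := height_facts ht
  obtain ⟨hinvπ, hinv2π⟩ := inv_pi_le
  have hπ := Real.pi_pos
  have hπ3 := Real.pi_gt_three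
  have ht0 : 0 < t := by linarith
  have ht10 : (10 : ℝ) ≤ t := by linarith
  have he3 : Real.exp 1 < 3 := lt_trans Real.exp_one_lt_d9 (by norm_num)
  set L : ℝ := Real.log t with hLdef
  set LL : ℝ := Real.log (Real.log t) with hLLdef
  set q : ℝ → ℝ := fun u ↦ 0.3083 * Real.log u + 4.128 with hqdef
  set Fρ : ℂ → ℝ := fun ρ ↦ (riemannZetaZeroOrder ρ : ℝ) / ‖1 + (t : ℂ) * I - ρ‖ ^ 2 with hF
  -- no zero has `Im ρ = 0`
  have him0 : ∀ ρ ∈ T, ρ.im ≠ 0 := by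
    intro ρ hρ h0
    obtain ⟨hz, h0', h1', -⟩ := hT ρ hρ
    exact riemannZeta_ne_zero_of_im_eq_zero_of_pos_of_lt_one h0 h0' h1' hz
  -- the partition
  set TW := T.filter fun ρ ↦ |ρ.im - t| < 1 with hTW
  set R1 := T.filter fun ρ ↦ ¬ (|ρ.im - t| < 1) with hR1
  set T1 := R1.filter fun ρ ↦ t + 1 ≤ ρ.im with hT1
  set R2 := R1.filter fun ρ ↦ ¬ (t + 1 ≤ ρ.im) with hR2
  set T2 := R2.filter fun ρ ↦ 0 < ρ.im with hT2
  set T3 := R2.filter fun ρ ↦ ¬ (0 < ρ.im) with hT3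
  have hsplit : ∑ ρ ∈ T, Fρ ρ = ∑ ρ ∈ TW, Fρ ρ + ∑ ρ ∈ T1, Fρ ρ + ∑ ρ ∈ T2, Fρ ρ + ∑ ρ ∈ T3, Fρ ρ := by
    rw [← Finset.sum_filter_add_sum_filter_not T (fun ρ ↦ |ρ.im - t| < 1) Fρ, ← hTW, ← hR1,
      ← Finset.sum_filter_add_sum_filter_not R1 (fun ρ ↦ t + 1 ≤ ρ.im) Fρ, ← hT1, ← hR2,
      ← Finset.sum_filter_add_sum_filter_not R2 (fun ρ ↦ 0 < ρ.im) Fρ, ← hT2, ← hT3]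
    ring
  have hbase : ∀ S : Finset ℂ, S ⊆ T → ∀ ρ ∈ S, riemannZeta ρ = 0 ∧ 0 < ρ.re ∧ ρ.re < 1 :=
    fun S hS ρ hρ ↦ ⟨(hT ρ (hS hρ)).1, (hT ρ (hS hρ)).2.1, (hT ρ (hS hρ)).2.2.1⟩
  have hR1sub : R1 ⊆ T := Finset.filter_subset _ _
  have hT1sub : T1 ⊆ T := (Finset.filter_subset _ _).trans hR1sub
  have hR2sub : R2 ⊆ T := (Finset.filter_subset _ _).trans hR1sub
  have hT2sub : T2 ⊆ T := (Finset.filter_subset _ _).trans hR2sub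
  have hT3sub : T3 ⊆ T := (Finset.filter_subset _ _).trans hR2sub
  have hW1 : ∀ ρ ∈ T1, riemannZeta ρ = 0 ∧ t + 1 ≤ ρ.im := fun ρ hρ ↦
    ⟨(hT ρ (hT1sub hρ)).1, (Finset.mem_filter.1 hρ).2⟩
  have hW2 : ∀ ρ ∈ T2, 0 < ρ.im ∧ ρ.im ≤ t - 1 := fun ρ hρ ↦ by
    have h2 := Finset.mem_filter.1 hρ
    have hr2 := Finset.mem_filter.1 h2.1
    have hr1 := Finset.mem_filter.1 hr2.1
    refine ⟨h2.2, ?_⟩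
    have hge : 1 ≤ |ρ.im - t| := not_lt.1 hr1.2
    have hlt : ρ.im < t + 1 := not_le.1 hr2.2
    rcases le_abs'.1 hge with h | h <;> linarith
  have hW3 : ∀ ρ ∈ T3, ρ.im < 0 := fun ρ hρ ↦ by
    have h3 := Finset.mem_filter.1 hρ
    exact lt_of_le_of_ne (not_lt.1 h3.2) (him0 ρ (hT3sub hρ))
  -- the explicit bound as hypotheses for `I₁`, `I₂` (threshold `30`)
  have hq₁ : ∀ u : ℝ, 30 ≤ u → (zetaZeroCount u : ℝ) ≤ rvmMain u + q u := fun u hu ↦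
    (explicit_bounds hu).2
  have hq₂ : ∀ u : ℝ, 30 ≤ u → rvmMain u - q u ≤ (zetaZeroCount u : ℝ) := fun u hu ↦
    (explicit_bounds hu).1
  have hq_mono : ∀ a b : ℝ, 30 ≤ a → a ≤ b → q a ≤ q b := fun a b ha hab ↦ by
    simp only [hqdef]
    have := Real.log_le_log (by linarith) hab
    linarith
  have hqm : MonotoneOn q (Set.Ici 30) := fun a ha b _ hab ↦ hq_mono a b (Set.mem_Ici.1 ha) hab
  have hq0 : 0 ≤ q 30 := by
    simp only [hqdef]
    have := Real.log_nonneg (show (1 : ℝ) ≤ 30 by norm_num)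
    positivity
  have hqg : ∀ u : ℝ, 30 ≤ u → q u ≤ 2 * Real.log u := fun u hu ↦ by
    simp only [hqdef]
    have h3 : (3 : ℝ) ≤ Real.log u := by
      rw [Real.le_log_iff_exp_le (by linarith)]
      have h := Real.exp_one_lt_d9
      have e3 : Real.exp 3 = Real.exp 1 ^ 3 := by rw [← Real.exp_nat_mul]; norm_num
      have hp : Real.exp 1 ^ 3 ≤ 2.7182818286 ^ 3 := pow_le_pow_left₀ (Real.exp_pos 1).le h.le 3
      rw [e3]; norm_num at hp; linarith
    linarith
  -- the four pieces
  have hS1 : ∑ ρ ∈ T1, Fρ ρ ≤ 1 / (2 * π) * (Real.log ((t + 1) / (2 * π)) + Real.log (t + 1) / t)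
      + q (t + 1) + q (2 * t) + 2 * (3 * Real.log (2 * t) + 1) / t ^ 2 :=
    sum_upper_ordinates_le_gen (by linarith) (by norm_num) (by norm_num) hq₁ hq₂ hqm hq0 hqg T1 hW1
  have hS2 : ∑ ρ ∈ T2, Fρ ρ ≤ 2 * q (t - 1) + 1 / (2 * π) * Real.log (t / (2 * π)) := by
    refine FordFarZeros.lower_tail_sum_le ht10 (hq0.trans (hq_mono _ _ le_rfl (by linarith))) T2
      (hbase T2 hT2sub) hW2 (fun u hu ↦ ?_) (hq₁ (t - 1) (by linarith))
    -- `M(u) − q(t−1) ≤ N(u)` on `[e, t−1]`: below `30` from `M ≤ 2.81 ≤ q`, above from the bound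
    rcases lt_or_ge u 30 with h30 | h30
    · have hM := main_le_of_le_thirty ((Real.exp_pos 1).trans_le hu.1) h30.le
      have hN0 : (0 : ℝ) ≤ zetaZeroCount u := Nat.cast_nonneg _
      have hq4 : 4.128 ≤ q (t - 1) := by
        simp only [hqdef]
        have := Real.log_nonneg (show (1 : ℝ) ≤ t - 1 by linarith)
        nlinarith
      unfold FordFarZeros.rvmMain
      linarith
    · have hb := (hq₂ u h30)
      have hm := hq_mono u (t - 1) h30 hu.2
      linarith
  have hS3 : ∑ ρ ∈ T3, Fρ ρ ≤ (3 * Real.log t + 2) / t + 20 / t ^ 2 :=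
    FordFarZeros.neg_ordinates_sum_le ht10 T3 (hbase T3 hT3sub) hW3 fun u hu ↦ count_le_crude_explicit hu
  have hS4 : ∑ ρ ∈ TW, Fρ ρ ≤ 80 / 9 * ((zetaZeroCount (t + 1) : ℝ) - zetaZeroCount (t - 1)) - fordN t η / η ^ 2
      + ∫ u in η..(1 / 4), 2 / u ^ 3 * fordN t u :=
    sum_window_part_le (by linarith) hη hη4 T hT
  have hWin := window_count_le_explicit (show (31 : ℝ) ≤ t by linarith)
  -- the annulus integral, with Lemma 4.5 at height `t`
  set α : ℝ := 1.3478 * B * L with hα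
  set β : ℝ := c45 + (Real.log A + 2 / 3 * LL) / 1.879 with hβ
  have hann : ∫ u in η..(1 / 4), 2 / u ^ 3 * fordN t u
      ≤ 4 * α * (1 / Real.sqrt η - 2) + β * (1 / η ^ 2 - 16)
        + 1 / 1.879 * (16 * Real.log (1 / 4) + 8 - Real.log η / η ^ 2 - 1 / (2 * η ^ 2)) := by
    refine annulus_integral_le hη hη4 (by norm_num) fun u hu1 hu2 ↦ ?_
    have hu0 : 0 < u := by linarith
    have h := h45 t u (by linarith) hu0 hu2
    have e : u ^ (3 / 2 : ℝ) = u * Real.sqrt u := by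
      rw [show (3 / 2 : ℝ) = 1 + 1 / 2 by norm_num, Real.rpow_add hu0, Real.rpow_one, Real.sqrt_eq_rpow]
    rw [e] at h
    have e2 : 1.3478 * (u * Real.sqrt u) * B * Real.log t + c45
        + (Real.log A - Real.log u + 2 / 3 * Real.log (Real.log t)) / 1.879
        = α * (u * Real.sqrt u) + β - Real.log u / 1.879 := by
      simp only [hα, hβ, hLdef, hLLdef]; ring
    linarith
  -- numerics
  have hq_t : q t = 0.3083 * L + 4.128 := rfl
  have hq_tm1 : q (t - 1) ≤ q t := hq_mono _ _ (by linarith) (by linarith)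
  have hq_tp1 : q (t + 1) ≤ 0.3083 * (L + 0.0001) + 4.128 := by
    simp only [hqdef]; linarith
  have hq_2t : q (2 * t) ≤ 0.3083 * (L + 0.6932) + 4.128 := by
    simp only [hqdef]; linarith
  have hlogt2π : Real.log (t / (2 * π)) ≤ L := FordFarZeros.log_div_two_pi_le ht0
  have hlogt12π : Real.log ((t + 1) / (2 * π)) ≤ L + 0.0001 := (FordFarZeros.log_div_two_pi_le (by linarith)).trans hl1
  have hlogt12π0 : 0 ≤ Real.log ((t + 1) / (2 * π)) :=
    Real.log_nonneg (by rw [le_div_iff₀ (by positivity)]; nlinarith [Real.pi_lt_d2])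
  have hlogt2π0 : 0 ≤ Real.log (t / (2 * π)) :=
    Real.log_nonneg (by rw [le_div_iff₀ (by positivity)]; nlinarith [Real.pi_lt_d2])
  -- `I₁` main term
  have hS1a : 1 / (2 * π) * (Real.log ((t + 1) / (2 * π)) + Real.log (t + 1) / t)
      ≤ 0.159155 * (L + 0.0001 + (L + 0.0001) * 0.0001) := by
    have h1 : Real.log (t + 1) / t ≤ (L + 0.0001) * 0.0001 := by
      rw [div_le_iff₀ ht0]
      have : 0 ≤ L + 0.0001 := by linarith
      nlinarith
    have h0 : 0 ≤ Real.log ((t + 1) / (2 * π)) + Real.log (t + 1) / t := by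
      have : 0 ≤ Real.log (t + 1) / t := div_nonneg (Real.log_nonneg (by linarith)) ht0.le
      linarith
    calc _ ≤ 0.159155 * (Real.log ((t + 1) / (2 * π)) + Real.log (t + 1) / t) :=
          mul_le_mul_of_nonneg_right hinv2π h0
      _ ≤ _ := mul_le_mul_of_nonneg_left (by linarith) (by norm_num)
  have hS1b : 2 * (3 * Real.log (2 * t) + 1) / t ^ 2 ≤ 0.0001 := by
    rw [div_le_iff₀ (by positivity)]
    have h1 : 2 * (3 * Real.log (2 * t) + 1) ≤ t := by linarith
    have h2 : t ≤ 0.0001 * t ^ 2 := by nlinarith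
    linarith
  -- `I₂` main term
  have hS2a : 1 / (2 * π) * Real.log (t / (2 * π)) ≤ 0.159155 * L :=
    calc _ ≤ 0.159155 * Real.log (t / (2 * π)) := mul_le_mul_of_nonneg_right hinv2π hlogt2π0
      _ ≤ _ := mul_le_mul_of_nonneg_left hlogt2π (by norm_num)
  -- `I₃`
  have hS3a : (3 * Real.log t + 2) / t + 20 / t ^ 2 ≤ 0.07 := by
    have h1 : (3 * Real.log t + 2) / t ≤ 0.0602 := by
      rw [div_le_iff₀ ht0]; linarith
    have h2 : 20 / t ^ 2 ≤ 0.0008 := by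
      rw [div_le_iff₀ (by positivity)]; nlinarith
    linarith
  -- window count main term
  have hS4a : 1 / π * Real.log ((t + 1) / (2 * π)) ≤ 0.31831 * (L + 0.0001) :=
    calc _ ≤ 0.31831 * Real.log ((t + 1) / (2 * π)) := mul_le_mul_of_nonneg_right hinvπ hlogt12π0
      _ ≤ _ := mul_le_mul_of_nonneg_left hlogt12π (by norm_num)
  have hWtm1 : 0.3083 * Real.log (t - 1) + 4.128 ≤ 0.3083 * L + 4.128 := by
    have := Real.log_le_log (by linarith : (0 : ℝ) < t - 1) (by linarith : t - 1 ≤ t)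
    linarith
  have hWtp1 : 0.3083 * Real.log (t + 1) + 4.128 ≤ 0.3083 * (L + 0.0001) + 4.128 := by linarith
  -- the annulus terms versus the target
  have hE0 : 0 < 1 / η ^ 2 := by positivity
  have hlog4 : 16 * Real.log (1 / 4) + 8 ≤ -14.179 := by
    rw [one_div, Real.log_inv, show (4 : ℝ) = 2 * 2 by norm_num, Real.log_mul (by norm_num) (by norm_num)]
    linarith [Real.log_two_gt_d9]
  have hlA : 0 ≤ Real.log A := Real.log_nonneg hA.le
  have hBLs : 0 ≤ B * L * (1 / Real.sqrt η - 2) := by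
    have hsη := two_le_one_div_sqrt hη hη4
    have : 0 ≤ L := by linarith
    have : 0 ≤ B * L := mul_nonneg hB.le this
    exact mul_nonneg this (by linarith)
  have hN0 := fordN_nonneg t η
  have hd : ∀ y : ℝ, y / 1.879 = y * (1000 / 1879) := fun y ↦ by rw [div_eq_mul_one_div]; norm_num
  have eα : 4 * α * (1 / Real.sqrt η - 2) = 5.3912 * (B * L * (1 / Real.sqrt η - 2)) := by
    simp only [hα]; ring
  set P : ℝ := B * L * (1 / Real.sqrt η - 2) with hP
  set X : ℝ := (Real.log A - Real.log η + 2 / 3 * LL) * (1000 / 1879) with hX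
  have eβ : β * (1 / η ^ 2 - 16) + 1 * (1000 / 1879) * (16 * Real.log (1 / 4) + 8 - Real.log η / η ^ 2 - 1 / (2 * η ^ 2))
      = 1 / η ^ 2 * (X + (c45 - 500 / 1879))
        - 16 * c45 - 16 * (Real.log A + 2 / 3 * LL) * (1000 / 1879)
        + (1000 / 1879) * (16 * Real.log (1 / 4) + 8) := by
    simp only [hβ, hX, hd]; field_simp; ring
  have hc16 : 0 ≤ 16 * c45 := by positivity
  have htarget_B : 5.3912 * P ≤ 5.392 * P := by
    have : 0 ≤ P := hBLs
    nlinarith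
  have hlog4' : (1000 / 1879 : ℝ) * (16 * Real.log (1 / 4) + 8) ≤ -7.546 := by
    rw [show (-7.546 : ℝ) = (1000 / 1879) * (-7.546 * 1.879) by norm_num]
    exact mul_le_mul_of_nonneg_left (by linarith) (by norm_num)
  simp only [hd] at hann
  -- staged linear assembly
  have hW' : ∑ ρ ∈ TW, Fρ ρ ≤ 80 / 9 * (0.31831 * (L + 0.0001)
      + (0.3083 * (L + 0.0001) + 4.128) + (0.3083 * L + 4.128))
      - fordN t η / η ^ 2 + 5.392 * P + 1 / η ^ 2 * (X + (c45 - 500 / 1879))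
      - 16 * c45 - 16 * (Real.log A + 2 / 3 * LL) * (1000 / 1879) - 7.546 := by
    linarith [hS4, hWin, hS4a, hWtp1, hWtm1, hann, eα, eβ, htarget_B, hlog4']
  have h1' : ∑ ρ ∈ T1, Fρ ρ ≤ 0.159155 * (L + 0.0001 + (L + 0.0001) * 0.0001)
      + (0.3083 * (L + 0.0001) + 4.128)
      + (0.3083 * (L + 0.6932) + 4.128) + 0.0001 := by
    linarith [hS1, hS1a, hS1b, hq_tp1, hq_2t]
  have h2' : ∑ ρ ∈ T2, Fρ ρ ≤ 2 * (0.3083 * L + 4.128) + 0.159155 * L := by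
    linarith [hS2, hS2a, hq_tm1, hq_t]
  have h3' : ∑ ρ ∈ T3, Fρ ρ ≤ 0.07 := hS3.trans hS3a
  unfold mtyFarZeroBoundGen
  rw [hsplit, ← hLLdef, ← hLdef]
  have eP : (9.862 + 5.392 * B * (1 / Real.sqrt η - 2)) * L = 9.862 * L + 5.392 * P := by
    simp only [hP]; ring
  have eX : 1 / η ^ 2 * ((Real.log A - Real.log η + 2 / 3 * LL) / 1.879 + (c45 - 500 / 1879) - fordN t η)
      = 1 / η ^ 2 * (X + (c45 - 500 / 1879)) - fordN t η / η ^ 2 := by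
    simp only [hX, hd]; ring
  rw [eP, eX]
  have hLLA : 0 ≤ 16 * (Real.log A + 2 / 3 * LL) * (1000 / 1879) := by positivity
  linarith [hW', h1', h2', h3', hlA, hL, hLL, hc16, hLLA]

end FarZeros

end Literature.NumberTheory.LFunctions
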